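import Summits.QuantumFields.YangMills.Theorems.BalabanUVNodesN19CoreMetric

/-!
# YM-DAG node N19 (= NE7 proper) — THE SOURCE SPLIT: `Spine.NE7.Core` ⟺ CLASS-UNIFORM VACUUM MATCHING at zero source ∧
# PER-CLASS MATCHING OF THE SOURCE RESPONSE; the insertion half from a derivative bound («the two runs' tilted insertion means
# agree»); the split at the Z-level and at the spine carriers (sibling leaf `…N19SourceSplitGuards`: what zero source alone gives, and
# the kernel guard that the vacuum half is load-bearing on the `Core` road and invisible at the Z-level)

Cell `pub-ymgap`, HUMAN RULING D-0062 (Track A), R141 (C) wider-strategy seat `pub-ymgap-dag-n19-e` (strategy s3 = ALTERNATIVE CURRENCY), third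
module of the seat (after `…Theorems.BalabanUVNodesN19BudgetRoad` p453434 — Σδ_K REDUCED to «weights summable + margin window» with `Core` AT THE
BUDGET displayed — and `…Theorems.BalabanUVNodesN19CoreMetric` p462782 — `Core` read INTRINSICALLY as a pseudo-metric ∕ summably bounded oscillation).
Route `Summits/QuantumFields/YangMills/Theses/BalabanUVNodes.lean` rev 15, cluster item K3′ «SpineGivenEndpointR12» (stmt-QuantumFields-19908; lineage K3
«SpineGivenEndpointR11» stmt-QuantumFields-19676, the key of modules 1–2); filed `--supports` that item `--as helper` (it proves no registered stub).
COUNT-NEUTRAL: elementary real analysis + bookkeeping by name; NOT a discharge claim.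

THE OBJECT AND THE SPLIT.  NE7 proper is `Spine.NE7.Core l₀ vol T Bad P Q δ` (`Spine/NE7/Targets.lean` :71): for every `K` ONE constant `c_K`,
independent of the source strength `t` and of the class, with `e^{c_K − vol·δ_K}·P ≤ Q ≤ e^{c_K + vol·δ_K}·P` at every good point `(t, τ)`,
`|t| ≤ l₀`, `τ ∈ T K ∖ Bad K t` (`P`, `Q` the two runs' shell-free cores).  The log-ratio `X_K(t,τ) = log Q_K(t,τ) − log P_K(t,τ)` is asked to be
constant up to `vol·δ_K` JOINTLY in the class `τ` and in the source `t`.  This module SPLITS that demand along the source: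
(V) VACUUM HALF — at zero source the log-ratio is CLASS-UNIFORM: `∃ c_K, |X_K(0,τ) − c_K| ≤ vol·δ⁰_K` for every class good at some admissible source
    (a two-run comparison of the VACUUM effective actions class by class — the part of Bałaban's programme [Balaban1987RG1]–[Balaban1989LargeFieldII]
    prints ONE RUN AT A TIME; the comparison is NOT PRINTED);
(I) INSERTION HALF — per class, the SOURCE RESPONSE of the log-ratio is small: `|X_K(t,τ) − X_K(0,τ)| ≤ vol·δ¹_K` (NO constant to name; a two-run
    comparison of the dressed OBSERVABLE INSERTIONS — the analysis [Balaban1989LargeFieldII] p. 356 defers: «expectation values of … loop variables …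
    deserve detailed analysis and further publication», quoted in the tree's `T4VarianceMatching` header; NOT PRINTED).
`Core` ⟸ (V) ∧ (I) with `δ = δ⁰ + δ¹`; conversely `Core δ` ⟹ (V) with `δ` and (I) with `2δ` (positive cores, `0 ≤ l₀`, and a class good at `t` is good
at `0`).  The split follows print's own division of labour (vacuum renormalization group ∕ observables) and names, for the planner, WHICH two-run
statement each half is; it proves neither.

WHAT IS KERNEL-CHECKED ([folklore] = elementary real analysis; [bookkeeping] = tree theorems BY NAME; 0 `def`, 0 `sorry`).
* §1 THE SPLIT.  `core_of_vacuum_of_insertion` ((V) δ⁰ ∧ (I) δ¹ ∧ positive cores ⇒ `Core (δ⁰ + δ¹)`, `NE7.sandwich_of_abs_log_sub_le` BY NAME) ·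
  `vacuum_of_core` · `insertion_of_core` (necessity, `N19CoreMetric.abs_log_sub_log_sub_le_of_sandwich` BY NAME; hypothesis `Bad K 0 ⊆ Bad K t`) ·
  `coreEdge_iff_vacuum_insertion` — N19's ∃δ-EDGE (`S_N19` under the pin of record) ⟺ «(V) and (I) with SUMMABLE remainders».
* §2 THE INSERTION HALF FROM A DERIVATIVE BOUND.  `insertion_of_lipschitzOn` (Lipschitz source response) · `insertion_of_hasDerivWithin` (if
  `s ↦ log P_K(s,τ)`, `s ↦ log Q_K(s,τ)` have derivatives `mP_K(s,τ)`, `mQ_K(s,τ)` within `[−l₀, l₀]` — in the dressed picture the TILTED INSERTION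
  MEANS of the observable under the class-`τ` term of either run — and `|mQ − mP| ≤ Λ_K` along the source segment of every good class, then (I) with
  `vol·δ¹_K = Λ_K·l₀`; Mathlib's `Convex.norm_image_sub_le_of_norm_hasDerivWithin_le`) · `core_of_vacuum_of_insertionDeriv` (the producer-facing face:
  class-uniform vacuum matching + agreement of the tilted insertion means ⇒ `Core`).
* §3 AT THE Z-LEVEL (one class, no bad class, cores `Z_K(t)`, `Z_{K+1}(t)` — the singleton reading of `N27xAtSpineCarriers.core_singleton_iff_matchingModConstants`):
  `vacuum_singleton` ((V) holds with ZERO remainder — at the Z-level the vacuum half is VACUOUS, absorbed by the constants) ·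
  `insertion_singleton_iff_genFun_increments` ((I) IS `|genFun Z (K+1) t − genFun Z K t| ≤ vol·δ¹_K` VERBATIM — the hypothesis of
  `N19CoreMetric.matchingModConstants_of_genFun_increments`).  So the vacuum half is EXACTLY what the `Core` road (K3's `S_N19`) asks beyond the
  node's DECL target `Spine.NE7.Target` at the partition functions; the sibling leaf makes this a kernel guard.
* §4 AT THE SPINE CARRIERS [bookkeeping] (`N19AtSpineCarriers.s_N19_of_coreEdge` BY NAME, under the `deltaOfRecord` pin of record; `SRec`, `Inputs`
  PARAMETERS): `s_N19_of_sourceSplitReading` (a reading handing positive shell-free cores on good classes, (V) and (I) with summable remainders ⇒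
  `YMDAG.UVSplit.S_N19 SRec Inputs`) · `s_N19_of_insertionDerivReading` (… handing (V), source-differentiable log-cores and agreement of the insertion
  means ⇒ `S_N19`).  READINGS for producers; nothing is produced here.
* SIBLING LEAF `…Theorems.BalabanUVNodesN19SourceSplitGuards` (same seat, filed after this one): what ZERO SOURCE alone gives (ℓ¹-close class
  weights and first-moment matching — the shape of the apex's `T4VarianceMatching.ExpectCauchyRate` socket, not of K3's `S_N19`; located remark) and the
  KERNEL GUARD that the vacuum half (V) is load-bearing on the `Core` road and invisible at the Z-level (a two-class toy meeting (I) and the DECL target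
  with zero remainder and admitting no summable `Core` family).

HONEST FRAMING.  NE7 ∕ NE7b ∕ NE7c are NOT PRINTED ([Balaban1987RG1]–[Balaban1989LargeFieldII] bound ONE run uniformly in `ε`; printed template
[King1986] (3.10)–(3.13) pp. 656–657, context only) and NOT PROVED; (V), (I), the derivative letters `mP`, `mQ`, `Λ`, and `Core`, `SRec`, `Inputs` occur
as hypotheses ∕ parameters only; nothing of Bałaban's is asserted or instantiated; N19 is NOT discharged; Track A count unmoved (A 5∕28).  One finite
four-torus at fixed ε, rung (B)+1 — NOT infinite volume, NOT OS on ℝ⁴, NOT a mass gap, NOT Clay.  THEOREMS ONLY; 0 sorry; standard axioms.  No decl below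
carries a cite tag.
-/

set_option autoImplicit false

noncomputable section

open Finset Filter Topology
open scoped BigOperators

namespace Summit.QuantumFields.YangMills.BalabanUVNodes.N19SourceSplit

open Literature.MathematicalPhysics.QuantumFieldTheory.Balaban1983to89
open T4CauchySum (MatchingModConstants genFun)
open Summit.QuantumFields.BalabanUV.T4Continuum.Spine
open Summit.QuantumFields.YangMills.BalabanUVNodes.N19AtSpineCarriers (deltaOfRecord s_N19_of_coreEdge)
open Summit.QuantumFields.YangMills.BalabanUVNodes.N19CoreMetric (abs_log_sub_log_sub_le_of_sandwich)
open YMDAG.UVSplit (SpineCarriers SpineRecordPred InputsPred S_N19)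

/-! ## §1 The split: `Core` ⟺ class-uniform vacuum matching ∧ per-class source-response matching [folklore] -/

section Split

variable {ι : Type*} [DecidableEq ι] {l₀ vol : ℝ} {T : ℕ → Finset ι} {Bad : ℕ → ℝ → Finset ι}
  {P Q : ℕ → ℝ → ι → ℝ} {δ δ₀ δ₁ : ℕ → ℝ}

/-- **SUFFICIENCY OF THE SPLIT.**  Positive cores at the good points, (V) a class-uniform VACUUM matching at zero source
`|log Q_K(0,τ) − log P_K(0,τ) − c_K| ≤ vol·δ⁰_K` (every class good at some admissible source) and (I) a per-class SOURCE-RESPONSE matching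
`|X_K(t,τ) − X_K(0,τ)| ≤ vol·δ¹_K` (`X = log Q − log P`; no constant) give `Core … (δ⁰ + δ¹)` with the vacuum constants — triangle inequality, then
`NE7.sandwich_of_abs_log_sub_le` BY NAME. [folklore] -/
theorem core_of_vacuum_of_insertion (hP : ∀ K t, |t| ≤ l₀ → ∀ τ ∈ T K \ Bad K t, 0 < P K t τ)
    (hQ : ∀ K t, |t| ≤ l₀ → ∀ τ ∈ T K \ Bad K t, 0 < Q K t τ)
    (hV : ∀ K, ∃ c : ℝ, ∀ t : ℝ, |t| ≤ l₀ → ∀ τ ∈ T K \ Bad K t,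
      |Real.log (Q K 0 τ) - Real.log (P K 0 τ) - c| ≤ vol * δ₀ K)
    (hI : ∀ K (t : ℝ), |t| ≤ l₀ → ∀ τ ∈ T K \ Bad K t,
      |(Real.log (Q K t τ) - Real.log (P K t τ)) - (Real.log (Q K 0 τ) - Real.log (P K 0 τ))| ≤ vol * δ₁ K) :
    NE7.Core l₀ vol T Bad P Q (fun K => δ₀ K + δ₁ K) := by
  intro K
  obtain ⟨c, hc⟩ := hV K
  refine ⟨c, fun t ht τ hτ => NE7.sandwich_of_abs_log_sub_le (hP K t ht τ hτ) (hQ K t ht τ hτ) ?_⟩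
  show |Real.log (Q K t τ) - Real.log (P K t τ) - c| ≤ vol * (δ₀ K + δ₁ K)
  have h1 := hc t ht τ hτ
  have h2 := hI K t ht τ hτ
  have e : Real.log (Q K t τ) - Real.log (P K t τ) - c
      = (Real.log (Q K 0 τ) - Real.log (P K 0 τ) - c)
        + ((Real.log (Q K t τ) - Real.log (P K t τ)) - (Real.log (Q K 0 τ) - Real.log (P K 0 τ))) := by ring
  rw [e, mul_add]
  exact (abs_add_le _ _).trans (add_le_add h1 h2)

/-- **NECESSITY, VACUUM HALF.**  Under `Core … δ` (run A's cores positive at the good points, `0 ≤ l₀` so that zero source is admissible, and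
`Bad K 0 ⊆ Bad K t`: a class good at `t` is good at `0`) the vacuum log-ratios are class-uniform up to `vol·δ_K`, with the SAME constants
(`N19CoreMetric.abs_log_sub_log_sub_le_of_sandwich` BY NAME). [folklore] -/
theorem vacuum_of_core (h : NE7.Core l₀ vol T Bad P Q δ) (hl₀ : 0 ≤ l₀) (hBad : ∀ K (t : ℝ), |t| ≤ l₀ → Bad K 0 ⊆ Bad K t)
    (hP : ∀ K t, |t| ≤ l₀ → ∀ τ ∈ T K \ Bad K t, 0 < P K t τ) :
    ∀ K, ∃ c : ℝ, ∀ t : ℝ, |t| ≤ l₀ → ∀ τ ∈ T K \ Bad K t,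
      |Real.log (Q K 0 τ) - Real.log (P K 0 τ) - c| ≤ vol * δ K := by
  intro K
  obtain ⟨c, hc⟩ := h K
  have h0 : |(0 : ℝ)| ≤ l₀ := by simpa using hl₀
  refine ⟨c, fun t ht τ hτ => ?_⟩
  have hτ0 : τ ∈ T K \ Bad K 0 := by
    rw [Finset.mem_sdiff] at hτ ⊢
    exact ⟨hτ.1, fun hb => hτ.2 (hBad K t ht hb)⟩
  exact abs_log_sub_log_sub_le_of_sandwich (hP K 0 h0 τ hτ0) (hc 0 h0 τ hτ0).1 (hc 0 h0 τ hτ0).2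

/-- **NECESSITY, INSERTION HALF.**  Under `Core … δ` (same side conditions) the source response of every good class's log-ratio is at most
`2·vol·δ_K`: both `X_K(t,τ)` and `X_K(0,τ)` lie within `vol·δ_K` of `c_K`. [folklore] -/
theorem insertion_of_core (h : NE7.Core l₀ vol T Bad P Q δ) (hl₀ : 0 ≤ l₀) (hBad : ∀ K (t : ℝ), |t| ≤ l₀ → Bad K 0 ⊆ Bad K t)
    (hP : ∀ K t, |t| ≤ l₀ → ∀ τ ∈ T K \ Bad K t, 0 < P K t τ) :
    ∀ K (t : ℝ), |t| ≤ l₀ → ∀ τ ∈ T K \ Bad K t,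
      |(Real.log (Q K t τ) - Real.log (P K t τ)) - (Real.log (Q K 0 τ) - Real.log (P K 0 τ))| ≤ 2 * (vol * δ K) := by
  intro K t ht τ hτ
  obtain ⟨c, hc⟩ := h K
  have h0 : |(0 : ℝ)| ≤ l₀ := by simpa using hl₀
  have hτ0 : τ ∈ T K \ Bad K 0 := by
    rw [Finset.mem_sdiff] at hτ ⊢
    exact ⟨hτ.1, fun hb => hτ.2 (hBad K t ht hb)⟩
  have h1 := abs_le.mp (abs_log_sub_log_sub_le_of_sandwich (hP K t ht τ hτ) (hc t ht τ hτ).1 (hc t ht τ hτ).2)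
  have h2 := abs_le.mp (abs_log_sub_log_sub_le_of_sandwich (hP K 0 h0 τ hτ0) (hc 0 h0 τ hτ0).1 (hc 0 h0 τ hτ0).2)
  rw [abs_le]
  constructor <;> linarith [h1.1, h1.2, h2.1, h2.2]

/-- **N19's ∃δ-EDGE, SPLIT ALONG THE SOURCE.**  For positive cores, `0 ≤ l₀` and `Bad K 0 ⊆ Bad K t`:
`(∃ δ, Core … δ ∧ Summable δ) ⟺ ∃ δ⁰ δ¹,` (V) with `δ⁰` `∧` (I) with `δ¹` `∧ Summable δ⁰ ∧ Summable δ¹` — NE7 proper is «summable class-uniform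
vacuum matching» AND «summable per-class source-response matching», nothing else. [folklore] -/
theorem coreEdge_iff_vacuum_insertion (hl₀ : 0 ≤ l₀) (hBad : ∀ K (t : ℝ), |t| ≤ l₀ → Bad K 0 ⊆ Bad K t)
    (hP : ∀ K t, |t| ≤ l₀ → ∀ τ ∈ T K \ Bad K t, 0 < P K t τ)
    (hQ : ∀ K t, |t| ≤ l₀ → ∀ τ ∈ T K \ Bad K t, 0 < Q K t τ) :
    (∃ δ : ℕ → ℝ, NE7.Core l₀ vol T Bad P Q δ ∧ Summable δ) ↔
      ∃ δ₀ δ₁ : ℕ → ℝ,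
        (∀ K, ∃ c : ℝ, ∀ t : ℝ, |t| ≤ l₀ → ∀ τ ∈ T K \ Bad K t,
          |Real.log (Q K 0 τ) - Real.log (P K 0 τ) - c| ≤ vol * δ₀ K) ∧
        (∀ K (t : ℝ), |t| ≤ l₀ → ∀ τ ∈ T K \ Bad K t,
          |(Real.log (Q K t τ) - Real.log (P K t τ)) - (Real.log (Q K 0 τ) - Real.log (P K 0 τ))| ≤ vol * δ₁ K) ∧
        Summable δ₀ ∧ Summable δ₁ := by
  constructor
  · rintro ⟨δ, hcore, hδ⟩
    refine ⟨δ, fun K => 2 * δ K, vacuum_of_core hcore hl₀ hBad hP, fun K t ht τ hτ => ?_, hδ, hδ.mul_left 2⟩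
    exact (insertion_of_core hcore hl₀ hBad hP K t ht τ hτ).trans (le_of_eq (by ring))
  · rintro ⟨δ₀, δ₁, hV, hI, h0, h1⟩
    exact ⟨fun K => δ₀ K + δ₁ K, core_of_vacuum_of_insertion hP hQ hV hI, h0.add h1⟩

end Split

/-! ## §2 The insertion half from a Lipschitz ∕ derivative bound on the source response [folklore] -/

section Deriv

variable {ι : Type*} [DecidableEq ι] {l₀ vol : ℝ} {T : ℕ → Finset ι} {Bad : ℕ → ℝ → Finset ι}
  {P Q mP mQ : ℕ → ℝ → ι → ℝ} {δ₀ Λ : ℕ → ℝ}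

/-- The source segment `[0, t]` (either orientation) of an admissible source lies in `[−l₀, l₀]`. [folklore] -/
theorem uIcc_subset_Icc_of_abs_le {t : ℝ} (ht : |t| ≤ l₀) : Set.uIcc (0 : ℝ) t ⊆ Set.Icc (-l₀) l₀ := by
  intro s hs
  rw [Set.mem_uIcc] at hs
  obtain ⟨h1, h2⟩ := abs_le.mp ht
  rcases hs with ⟨hs1, hs2⟩ | ⟨hs1, hs2⟩ <;> exact ⟨by linarith, by linarith⟩

/-- **(I) FROM A LIPSCHITZ SOURCE RESPONSE**: if every good class's log-ratio is `Λ_K`-Lipschitz in the source along its source segment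
(`0 ≤ Λ_K`), the insertion half holds with `Λ_K·l₀` in place of `vol·δ¹_K`. [folklore] -/
theorem insertion_of_lipschitzOn (hΛ : ∀ K, 0 ≤ Λ K)
    (hLip : ∀ K (t : ℝ), |t| ≤ l₀ → ∀ τ ∈ T K \ Bad K t, ∀ s ∈ Set.uIcc (0 : ℝ) t, ∀ s' ∈ Set.uIcc (0 : ℝ) t,
      |(Real.log (Q K s τ) - Real.log (P K s τ)) - (Real.log (Q K s' τ) - Real.log (P K s' τ))| ≤ Λ K * |s - s'|) :
    ∀ K (t : ℝ), |t| ≤ l₀ → ∀ τ ∈ T K \ Bad K t,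
      |(Real.log (Q K t τ) - Real.log (P K t τ)) - (Real.log (Q K 0 τ) - Real.log (P K 0 τ))| ≤ Λ K * l₀ := by
  intro K t ht τ hτ
  have h := hLip K t ht τ hτ t Set.right_mem_uIcc 0 Set.left_mem_uIcc
  rw [sub_zero] at h
  exact h.trans (mul_le_mul_of_nonneg_left ht (hΛ K))

/-- **(I) FROM A DERIVATIVE BOUND — «THE TWO RUNS' TILTED INSERTION MEANS AGREE».**  If for every class the log-cores `s ↦ log P_K(s,τ)`,
`s ↦ log Q_K(s,τ)` have derivatives `mP_K(s,τ)`, `mQ_K(s,τ)` within `[−l₀, l₀]` (in the dressed picture: the means of the observable insertion under the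
source-tilted class-`τ` term of run A ∕ run B), and along the source segment of every good class `|mQ − mP| ≤ Λ_K` (`0 ≤ Λ_K`), then the insertion
half holds with `Λ_K·l₀` — the mean value inequality (`Convex.norm_image_sub_le_of_norm_hasDerivWithin_le`) for `X_K(·,τ)` on `[0, t]`. [folklore] -/
theorem insertion_of_hasDerivWithin (hΛ : ∀ K, 0 ≤ Λ K)
    (hdP : ∀ K, ∀ τ ∈ T K, ∀ s ∈ Set.Icc (-l₀) l₀,
      HasDerivWithinAt (fun s => Real.log (P K s τ)) (mP K s τ) (Set.Icc (-l₀) l₀) s)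
    (hdQ : ∀ K, ∀ τ ∈ T K, ∀ s ∈ Set.Icc (-l₀) l₀,
      HasDerivWithinAt (fun s => Real.log (Q K s τ)) (mQ K s τ) (Set.Icc (-l₀) l₀) s)
    (hm : ∀ K (t : ℝ), |t| ≤ l₀ → ∀ τ ∈ T K \ Bad K t, ∀ s ∈ Set.uIcc (0 : ℝ) t, |mQ K s τ - mP K s τ| ≤ Λ K) :
    ∀ K (t : ℝ), |t| ≤ l₀ → ∀ τ ∈ T K \ Bad K t,
      |(Real.log (Q K t τ) - Real.log (P K t τ)) - (Real.log (Q K 0 τ) - Real.log (P K 0 τ))| ≤ Λ K * l₀ := by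
  intro K t ht τ hτ
  have hτT : τ ∈ T K := (Finset.mem_sdiff.mp hτ).1
  have hsub : Set.uIcc (0 : ℝ) t ⊆ Set.Icc (-l₀) l₀ := uIcc_subset_Icc_of_abs_le ht
  have hderiv : ∀ s ∈ Set.uIcc (0 : ℝ) t,
      HasDerivWithinAt (fun s => Real.log (Q K s τ) - Real.log (P K s τ))
        ((fun s => mQ K s τ - mP K s τ) s) (Set.uIcc (0 : ℝ) t) s := fun s hs =>
    ((hdQ K τ hτT s (hsub hs)).mono hsub).sub ((hdP K τ hτT s (hsub hs)).mono hsub)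
  have hbound : ∀ s ∈ Set.uIcc (0 : ℝ) t, ‖(fun s => mQ K s τ - mP K s τ) s‖ ≤ Λ K := fun s hs => by
    rw [Real.norm_eq_abs]
    exact hm K t ht τ hτ s hs
  have hmvt := (convex_uIcc (0 : ℝ) t).norm_image_sub_le_of_norm_hasDerivWithin_le hderiv hbound
    Set.left_mem_uIcc Set.right_mem_uIcc
  simp only [Real.norm_eq_abs, sub_zero] at hmvt
  exact hmvt.trans (mul_le_mul_of_nonneg_left ht (hΛ K))

/-- **THE PRODUCER-FACING FACE: `Core` ⟸ class-uniform VACUUM matching ∧ agreement of the TILTED INSERTION MEANS** (`0 < vol`): (V) with `δ⁰`,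
source-differentiable positive log-cores on `[−l₀, l₀]`, and `|mQ − mP| ≤ Λ_K` along the source segment of every good class give
`Core … (δ⁰_K + Λ_K·l₀∕vol)`.  Both inputs are two-run statements NOT PRINTED; nothing is produced here. [folklore] -/
theorem core_of_vacuum_of_insertionDeriv (hvol : 0 < vol) (hΛ : ∀ K, 0 ≤ Λ K)
    (hP : ∀ K t, |t| ≤ l₀ → ∀ τ ∈ T K \ Bad K t, 0 < P K t τ)
    (hQ : ∀ K t, |t| ≤ l₀ → ∀ τ ∈ T K \ Bad K t, 0 < Q K t τ)
    (hV : ∀ K, ∃ c : ℝ, ∀ t : ℝ, |t| ≤ l₀ → ∀ τ ∈ T K \ Bad K t,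
      |Real.log (Q K 0 τ) - Real.log (P K 0 τ) - c| ≤ vol * δ₀ K)
    (hdP : ∀ K, ∀ τ ∈ T K, ∀ s ∈ Set.Icc (-l₀) l₀,
      HasDerivWithinAt (fun s => Real.log (P K s τ)) (mP K s τ) (Set.Icc (-l₀) l₀) s)
    (hdQ : ∀ K, ∀ τ ∈ T K, ∀ s ∈ Set.Icc (-l₀) l₀,
      HasDerivWithinAt (fun s => Real.log (Q K s τ)) (mQ K s τ) (Set.Icc (-l₀) l₀) s)
    (hm : ∀ K (t : ℝ), |t| ≤ l₀ → ∀ τ ∈ T K \ Bad K t, ∀ s ∈ Set.uIcc (0 : ℝ) t, |mQ K s τ - mP K s τ| ≤ Λ K) :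
    NE7.Core l₀ vol T Bad P Q (fun K => δ₀ K + Λ K * l₀ / vol) := by
  refine core_of_vacuum_of_insertion hP hQ hV fun K t ht τ hτ => ?_
  have e : vol * (Λ K * l₀ / vol) = Λ K * l₀ := by field_simp
  rw [e]
  exact insertion_of_hasDerivWithin hΛ hdP hdQ hm K t ht τ hτ

end Deriv

/-! ## §3 At the Z-level: the vacuum half is vacuous, the insertion half IS the generating-function increment [folklore] -/

section ZLevel

variable {l₀ vol : ℝ} {Z : ℕ → ℝ → ℝ} {δ₁ : ℕ → ℝ}

/-- **ON A ONE-CLASS FAMILY THE VACUUM HALF IS FREE**: (V) holds with ZERO remainder for ANY cores and any bad-class datum — take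
`c_K := log Q_K(0,⋆) − log P_K(0,⋆)`.  At the level of partition functions every vacuum discrepancy is a constant. [folklore] -/
theorem vacuum_singleton (P Q : ℕ → ℝ → Unit → ℝ) (Bad : ℕ → ℝ → Finset Unit) :
    ∀ K, ∃ c : ℝ, ∀ t : ℝ, |t| ≤ l₀ → ∀ τ ∈ (fun _ : ℕ => ({()} : Finset Unit)) K \ Bad K t,
      |Real.log (Q K 0 τ) - Real.log (P K 0 τ) - c| ≤ vol * (fun _ : ℕ => (0 : ℝ)) K := fun K =>
  ⟨Real.log (Q K 0 ()) - Real.log (P K 0 ()), fun t _ τ _ => by simp⟩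

/-- **ON THE SINGLETON EXPANSION OF A FAMILY `Z` THE INSERTION HALF IS THE INCREMENT BOUND OF THE GENERATING FUNCTIONS, VERBATIM**
(one class carrying `Z_K(t)` ∕ `Z_{K+1}(t)`, no bad class — the reading of `N27xAtSpineCarriers.core_singleton_iff_matchingModConstants`):
(I) with `δ¹` ⟺ `∀ K t, |t| ≤ l₀ → |genFun Z (K+1) t − genFun Z K t| ≤ vol·δ¹_K`, the hypothesis of
`N19CoreMetric.matchingModConstants_of_genFun_increments` (`T4CauchySum.genFun Z K t = log Z_K(t) − log Z_K(0)`).  With `vacuum_singleton` and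
`core_of_vacuum_of_insertion`: at the Z-level the split IS the Z-level twin of module 2 §4 — the vacuum half is what the term-wise road adds. [folklore] -/
theorem insertion_singleton_iff_genFun_increments :
    (∀ K (t : ℝ), |t| ≤ l₀ → ∀ τ ∈ (fun _ : ℕ => ({()} : Finset Unit)) K \ (fun (_ : ℕ) (_ : ℝ) => (∅ : Finset Unit)) K t,
      |(Real.log ((fun K t (_ : Unit) => Z (K + 1) t) K t τ) - Real.log ((fun K t (_ : Unit) => Z K t) K t τ)) -
        (Real.log ((fun K t (_ : Unit) => Z (K + 1) t) K 0 τ) - Real.log ((fun K t (_ : Unit) => Z K t) K 0 τ))| ≤ vol * δ₁ K) ↔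
    ∀ K (t : ℝ), |t| ≤ l₀ → |genFun Z (K + 1) t - genFun Z K t| ≤ vol * δ₁ K := by
  have e : ∀ K (t : ℝ), (Real.log (Z (K + 1) t) - Real.log (Z K t)) - (Real.log (Z (K + 1) 0) - Real.log (Z K 0))
      = genFun Z (K + 1) t - genFun Z K t := fun K t => by
    unfold genFun; ring
  refine forall_congr' fun K => forall_congr' fun t => forall_congr' fun _ => ?_
  constructor
  · intro h
    rw [← e]
    exact h () (by simp)
  · intro h τ _
    rw [e]
    exact h

end ZLevel

/-! ## §4 At the spine carriers: `S_N19` from a source-split reading ∕ from an insertion-derivative reading [bookkeeping] -/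

section Carriers

variable {N : ℕ} [NeZero N]

/-- **`S_N19` FROM A SOURCE-SPLIT READING** (under the `deltaOfRecord` pin of record): if the carriers of record and K4's inputs hand, for every bundle,
POSITIVE shell-free cores `A − shA`, `B − shB` on the good classes, a class-uniform VACUUM matching (V) and a per-class SOURCE-RESPONSE matching (I) of
`log (B − shB) − log (A − shA)` with SUMMABLE remainders `δ⁰`, `δ¹`, then `YMDAG.UVSplit.S_N19 SRec Inputs` (`s_N19_of_coreEdge` BY NAME ∘ §1);
`SRec`, `Inputs` PARAMETERS; both halves NOT PRINTED, NOT produced here. [folklore] -/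
theorem s_N19_of_sourceSplitReading (SRec : SpineRecordPred N) (Inputs : InputsPred N)
    (hpin : ∀ (F : T4Continuum.T4Family) (D : YMDAG.UVSplit.Datum F N) (g₀ : ℕ → ℝ) (os : List (T4Continuum.ULoop F))
      (S : SpineCarriers), SRec F D g₀ os S → letI := S.dec
      S.δ = deltaOfRecord S.l₀ S.vol S.T S.Bad (fun K t τ => S.A K t τ - S.shA K t τ) (fun K t τ => S.B K t τ - S.shB K t τ))
    (hread : ∀ (F : T4Continuum.T4Family) (D : YMDAG.UVSplit.Datum F N) (g₀ : ℕ → ℝ) (os : List (T4Continuum.ULoop F))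
      (S : SpineCarriers), SRec F D g₀ os S → Inputs F D g₀ os → letI := S.dec
      (∀ K t, |t| ≤ S.l₀ → ∀ τ ∈ S.T K \ S.Bad K t, 0 < S.A K t τ - S.shA K t τ ∧ 0 < S.B K t τ - S.shB K t τ) ∧
      ∃ δ₀ δ₁ : ℕ → ℝ, Summable δ₀ ∧ Summable δ₁ ∧
        (∀ K, ∃ c : ℝ, ∀ t : ℝ, |t| ≤ S.l₀ → ∀ τ ∈ S.T K \ S.Bad K t,
          |Real.log (S.B K 0 τ - S.shB K 0 τ) - Real.log (S.A K 0 τ - S.shA K 0 τ) - c| ≤ S.vol * δ₀ K) ∧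
        (∀ K (t : ℝ), |t| ≤ S.l₀ → ∀ τ ∈ S.T K \ S.Bad K t,
          |(Real.log (S.B K t τ - S.shB K t τ) - Real.log (S.A K t τ - S.shA K t τ)) -
              (Real.log (S.B K 0 τ - S.shB K 0 τ) - Real.log (S.A K 0 τ - S.shA K 0 τ))| ≤ S.vol * δ₁ K)) :
    S_N19 SRec Inputs := by
  refine s_N19_of_coreEdge SRec Inputs hpin fun F D g₀ os S hS hI => ?_
  letI := S.dec
  obtain ⟨hpos, δ₀, δ₁, h0, h1, hV, hIns⟩ := hread F D g₀ os S hS hI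
  exact ⟨fun K => δ₀ K + δ₁ K,
    core_of_vacuum_of_insertion (fun K t ht τ hτ => (hpos K t ht τ hτ).1) (fun K t ht τ hτ => (hpos K t ht τ hτ).2) hV hIns,
    h0.add h1⟩

/-- **`S_N19` FROM AN INSERTION-DERIVATIVE READING** (under the pin of record): if the carriers and K4's inputs hand, for every bundle, `0 < S.vol`,
positive shell-free cores on the good classes, a class-uniform VACUUM matching with summable remainder, SOURCE-DIFFERENTIABLE log-cores on
`[−S.l₀, S.l₀]` with derivatives `mA`, `mB` (the two runs' tilted insertion means), and `|mB − mA| ≤ Λ_K` along the source segment of every good class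
with `0 ≤ Λ` SUMMABLE, then `S_N19 SRec Inputs` (`s_N19_of_coreEdge` ∘ `core_of_vacuum_of_insertionDeriv`). [folklore] -/
theorem s_N19_of_insertionDerivReading (SRec : SpineRecordPred N) (Inputs : InputsPred N)
    (hpin : ∀ (F : T4Continuum.T4Family) (D : YMDAG.UVSplit.Datum F N) (g₀ : ℕ → ℝ) (os : List (T4Continuum.ULoop F))
      (S : SpineCarriers), SRec F D g₀ os S → letI := S.dec
      S.δ = deltaOfRecord S.l₀ S.vol S.T S.Bad (fun K t τ => S.A K t τ - S.shA K t τ) (fun K t τ => S.B K t τ - S.shB K t τ))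
    (hread : ∀ (F : T4Continuum.T4Family) (D : YMDAG.UVSplit.Datum F N) (g₀ : ℕ → ℝ) (os : List (T4Continuum.ULoop F))
      (S : SpineCarriers), SRec F D g₀ os S → Inputs F D g₀ os → letI := S.dec
      0 < S.vol ∧
      (∀ K t, |t| ≤ S.l₀ → ∀ τ ∈ S.T K \ S.Bad K t, 0 < S.A K t τ - S.shA K t τ ∧ 0 < S.B K t τ - S.shB K t τ) ∧
      ∃ (δ₀ Λ : ℕ → ℝ) (mA mB : ℕ → ℝ → S.ι → ℝ), Summable δ₀ ∧ Summable Λ ∧ (∀ K, 0 ≤ Λ K) ∧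
        (∀ K, ∃ c : ℝ, ∀ t : ℝ, |t| ≤ S.l₀ → ∀ τ ∈ S.T K \ S.Bad K t,
          |Real.log (S.B K 0 τ - S.shB K 0 τ) - Real.log (S.A K 0 τ - S.shA K 0 τ) - c| ≤ S.vol * δ₀ K) ∧
        (∀ K, ∀ τ ∈ S.T K, ∀ s ∈ Set.Icc (-S.l₀) S.l₀,
          HasDerivWithinAt (fun s => Real.log (S.A K s τ - S.shA K s τ)) (mA K s τ) (Set.Icc (-S.l₀) S.l₀) s) ∧
        (∀ K, ∀ τ ∈ S.T K, ∀ s ∈ Set.Icc (-S.l₀) S.l₀,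
          HasDerivWithinAt (fun s => Real.log (S.B K s τ - S.shB K s τ)) (mB K s τ) (Set.Icc (-S.l₀) S.l₀) s) ∧
        (∀ K (t : ℝ), |t| ≤ S.l₀ → ∀ τ ∈ S.T K \ S.Bad K t, ∀ s ∈ Set.uIcc (0 : ℝ) t, |mB K s τ - mA K s τ| ≤ Λ K)) :
    S_N19 SRec Inputs := by
  refine s_N19_of_coreEdge SRec Inputs hpin fun F D g₀ os S hS hI => ?_
  letI := S.dec
  obtain ⟨hvol, hpos, δ₀, Λ, mA, mB, h0, hΛs, hΛ, hV, hdA, hdB, hm⟩ := hread F D g₀ os S hS hI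
  exact ⟨fun K => δ₀ K + Λ K * S.l₀ / S.vol,
    core_of_vacuum_of_insertionDeriv hvol hΛ (fun K t ht τ hτ => (hpos K t ht τ hτ).1)
      (fun K t ht τ hτ => (hpos K t ht τ hτ).2) hV hdA hdB hm,
    h0.add ((hΛs.mul_right S.l₀).div_const S.vol)⟩

end Carriers

end Summit.QuantumFields.YangMills.BalabanUVNodes.N19SourceSplit

end
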